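import Mathlib
import Summits.MatrixMultiplication.MatrixMultiplication.Theorems.SnSubsetDichotomyHyperoctahedralThresholdDeckTwin
import Summits.MatrixMultiplication.MatrixMultiplication.Theorems.SnSubsetDichotomyHyperoctahedralThresholdCleanReflection

/-!
# `SnSubsetDichotomy.HyperoctahedralThreshold` — deck twins over an equal-class dumbbell

Helper for crux `stmt-MatrixMultiplication-10883` (line `refutation-local-symmetry`, open core
`stub_poorRigidCore`; siege seat k21).  Second brick of the k21 memo's Theorem A ("a colour symmetry of
prime order `p ≥ 5` forces a clean closed rung walk with `O(log n)` rungs"), after the landed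
`deckTwin_cleanWalk` (p114719): the DUMBBELL branch.

Setting (the line's vocabulary, host terms only — no quotient is formed): three colours
`μ c : Equiv.Perm (Fin n)` that are involutions, words acting on the right by `List.foldl (fun v c => μ c v)`,
and a colour symmetry `θ` (`θ (μ c v) = μ c (θ v)`).  Upstairs picture of a dumbbell of the quotient
`Γ/⟨θ⟩` whose two cycles have opposite voltage (`±a`; re-orient one cycle if they are equal): a point `w`,
a word `c₁` with `w · c₁ = θ^a w` (lift of the first cycle), a connecting word `u` with `w · u = θ^e w'`,
and a word `c₂` with `w' · c₂ = θ^(-a) w'` (lift of the second cycle, read backwards).  Then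

* `DeckDumbbell.closed` — the dumbbell word `z = c₁ ++ u ++ c₂ ++ u.reverse` is CLOSED at `w`
  (total voltage `a + e - a - e = 0`);
* `DeckDumbbell.noCross` — if the base points of the configuration (the `c₁`-trajectory of `w`, the
  `u`-trajectory of `w` without its start, the interior of the `c₂`-trajectory of `w'`) lie in pairwise
  distinct `θ`-orbits (this is what "simple cycles, internally disjoint path, disjoint cycles" means
  downstairs), then for every exponent `j` such that `θ^j`, `θ^(j+a)`, `θ^(j-a)` move `w` — and powers of
  `θ` fixing one point fix `w` (free deck group) — the trajectories of `w` and of `θ^j w` under `z` never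
  cross: the SHEET GAPS of the dumbbell walk lie in `{0, a, -a}` (memo Lemma 3(c));
* `deckDumbbell_cleanWalk` — hence, with `deckTwin_cleanWalk`, clean closed-rung-walk data in the exact
  output format of the core with `k + 1 = |z| = |c₁| + 2|u| + |c₂|` rungs, all points outside `R`.

Pure finite combinatorics (segment bookkeeping of `List.take` over the four pieces of `z`;
`CleanReflection.act_reverse(_take)` for the way back along `u`). [this line, k21 memo §3]
-/

-- the project's summit namespace `Summit.MatrixMultiplication.MatrixMultiplication` repeats a component by design (D-0022)
set_option linter.dupNamespace false

namespace Summit.MatrixMultiplication.MatrixMultiplication.Theorems.HyperoctahedralThreshold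

open Equiv

namespace DeckDumbbell

variable {n : ℕ}

/-- **Powers of a colour symmetry are colour symmetries.** [folklore] -/
theorem zpow_comm (μ : Fin 3 → Perm (Fin n)) (θ : Perm (Fin n))
    (hθ : ∀ c v, θ (μ c v) = μ c (θ v)) (k : ℤ) (c : Fin 3) (v : Fin n) :
    (θ ^ k) (μ c v) = μ c ((θ ^ k) v) := by
  have hc : Commute θ (μ c) := Equiv.ext fun x => by simpa [Perm.mul_apply] using hθ c x
  have hk : Commute (θ ^ k) (μ c) := hc.zpow_left k
  have := congrArg (fun f : Perm (Fin n) => f v) hk.eq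
  simpa [Perm.mul_apply] using this

/-- Composition of powers, pointwise: `θ^k (θ^l x) = θ^(k+l) x`. [folklore] -/
theorem zpow_app (θ : Perm (Fin n)) (k l : ℤ) (x : Fin n) :
    (θ ^ k) ((θ ^ l) x) = (θ ^ (k + l)) x := by
  rw [← Perm.mul_apply, ← zpow_add]

/-- Transport of an equation between translates: `θ^α x = θ^β y → x = θ^(-α+β) y`. [folklore] -/
theorem eq_zpow_of_zpow_eq (θ : Perm (Fin n)) {α β : ℤ} {x y : Fin n}
    (h : (θ ^ α) x = (θ ^ β) y) : x = (θ ^ (-α + β)) y := by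
  have := congrArg (θ ^ (-α)) h
  rwa [zpow_app, zpow_app, neg_add_cancel, zpow_zero, Perm.one_apply] at this

/-- `take` past a prefix: `(l₁ ++ l₂).take (|l₁| + i) = l₁ ++ l₂.take i`. [folklore] -/
theorem take_length_add {α : Type*} (l₁ l₂ : List α) (i : ℕ) :
    (l₁ ++ l₂).take (l₁.length + i) = l₁ ++ l₂.take i := by
  rw [List.take_append, List.take_of_length_le (by omega), Nat.add_sub_cancel_left]

/-- Flip a translate relation: `x = θ^k y → y = θ^(-k) x`. [folklore] -/
theorem eq_zpow_symm (θ : Perm (Fin n)) {k : ℤ} {x y : Fin n} (h : x = (θ ^ k) y) :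
    y = (θ ^ (-k)) x := by
  rw [h, zpow_app, neg_add_cancel, zpow_zero, Perm.one_apply]

/-- **The dumbbell word is closed.**  With `w · c₁ = θ^a w`, `w · u = θ^e w'`, `w' · c₂ = θ^(-a) w'`
(involution letters, `θ` a colour symmetry): `w · (c₁ ++ u ++ c₂ ++ u.reverse) = w`. [this line] -/
theorem closed (μ : Fin 3 → Perm (Fin n)) (hμ : ∀ c, μ c * μ c = 1) (θ : Perm (Fin n))
    (hθ : ∀ c v, θ (μ c v) = μ c (θ v)) (c₁ u c₂ : List (Fin 3)) (w w' : Fin n) (a e : ℤ)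
    (h1 : c₁.foldl (fun v c => μ c v) w = (θ ^ a) w)
    (h2 : u.foldl (fun v c => μ c v) w = (θ ^ e) w')
    (h3 : c₂.foldl (fun v c => μ c v) w' = (θ ^ (-a)) w') :
    (c₁ ++ (u ++ (c₂ ++ u.reverse))).foldl (fun v c => μ c v) w = w := by
  rw [CleanReflection.act_append, h1, CleanReflection.act_append,
    DeckTwin.foldl_act_comm μ (θ ^ a) (zpow_comm μ θ hθ a) u w, h2,
    CleanReflection.act_append, zpow_app,
    DeckTwin.foldl_act_comm μ (θ ^ (a + e)) (zpow_comm μ θ hθ (a + e)) c₂ w', h3, zpow_app,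
    show a + e + -a = e by ring, ← h2]
  exact CleanReflection.act_reverse μ hμ u w

/-- Segment 1 of the dumbbell trajectory: for `s ≤ |c₁|`, `w · z.take s = w · c₁.take s`. [this line] -/
theorem seg1 (μ : Fin 3 → Perm (Fin n)) (c₁ rest : List (Fin 3)) (w : Fin n) (s : ℕ)
    (hs : s ≤ c₁.length) :
    ((c₁ ++ rest).take s).foldl (fun v c => μ c v) w = (c₁.take s).foldl (fun v c => μ c v) w := by
  rw [List.take_append_of_le_length hs]

/-- Segment 2: for `s' ≤ |u|`, `w · z.take (|c₁| + s') = θ^a (w · u.take s')`. [this line] -/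
theorem seg2 (μ : Fin 3 → Perm (Fin n)) (θ : Perm (Fin n)) (hθ : ∀ c v, θ (μ c v) = μ c (θ v))
    (c₁ u rest : List (Fin 3)) (w : Fin n) (a : ℤ)
    (h1 : c₁.foldl (fun v c => μ c v) w = (θ ^ a) w) (s' : ℕ) (hs : s' ≤ u.length) :
    ((c₁ ++ (u ++ rest)).take (c₁.length + s')).foldl (fun v c => μ c v) w =
      (θ ^ a) ((u.take s').foldl (fun v c => μ c v) w) := by
  rw [take_length_add, List.take_append_of_le_length hs, CleanReflection.act_append, h1,
    DeckTwin.foldl_act_comm μ (θ ^ a) (zpow_comm μ θ hθ a)]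

/-- Segment 3: for `s'' ≤ |c₂|`, `w · z.take (|c₁| + |u| + s'') = θ^(a+e) (w' · c₂.take s'')`. [this line] -/
theorem seg3 (μ : Fin 3 → Perm (Fin n)) (θ : Perm (Fin n)) (hθ : ∀ c v, θ (μ c v) = μ c (θ v))
    (c₁ u c₂ rest : List (Fin 3)) (w w' : Fin n) (a e : ℤ)
    (h1 : c₁.foldl (fun v c => μ c v) w = (θ ^ a) w)
    (h2 : u.foldl (fun v c => μ c v) w = (θ ^ e) w') (s'' : ℕ) (hs : s'' ≤ c₂.length) :
    ((c₁ ++ (u ++ (c₂ ++ rest))).take (c₁.length + (u.length + s''))).foldl (fun v c => μ c v) w =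
      (θ ^ (a + e)) ((c₂.take s'').foldl (fun v c => μ c v) w') := by
  rw [take_length_add, take_length_add, List.take_append_of_le_length hs,
    CleanReflection.act_append, h1, CleanReflection.act_append,
    DeckTwin.foldl_act_comm μ (θ ^ a) (zpow_comm μ θ hθ a) u w, h2, zpow_app,
    DeckTwin.foldl_act_comm μ (θ ^ (a + e)) (zpow_comm μ θ hθ (a + e))]

/-- Segment 4: for `s''' ≤ |u|`, `w · z.take (|c₁| + |u| + |c₂| + s''') = w · u.take (|u| - s''')`
(the way back along `u`; letters are involutions). [this line] -/
theorem seg4 (μ : Fin 3 → Perm (Fin n)) (hμ : ∀ c, μ c * μ c = 1) (θ : Perm (Fin n))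
    (hθ : ∀ c v, θ (μ c v) = μ c (θ v)) (c₁ u c₂ : List (Fin 3)) (w w' : Fin n) (a e : ℤ)
    (h1 : c₁.foldl (fun v c => μ c v) w = (θ ^ a) w)
    (h2 : u.foldl (fun v c => μ c v) w = (θ ^ e) w')
    (h3 : c₂.foldl (fun v c => μ c v) w' = (θ ^ (-a)) w') (s''' : ℕ) :
    ((c₁ ++ (u ++ (c₂ ++ u.reverse))).take (c₁.length + (u.length + (c₂.length + s''')))).foldl
        (fun v c => μ c v) w = (u.take (u.length - s''')).foldl (fun v c => μ c v) w := by
  rw [take_length_add, take_length_add, take_length_add, CleanReflection.act_append, h1,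
    CleanReflection.act_append, DeckTwin.foldl_act_comm μ (θ ^ a) (zpow_comm μ θ hθ a) u w, h2,
    CleanReflection.act_append, zpow_app,
    DeckTwin.foldl_act_comm μ (θ ^ (a + e)) (zpow_comm μ θ hθ (a + e)) c₂ w', h3, zpow_app,
    show a + e + -a = e by ring, ← h2]
  exact CleanReflection.act_reverse_take μ hμ u w s'''

/-- **Representation of the dumbbell trajectory.**  Every trajectory point `w · z.take s` of
`z = c₁ ++ u ++ c₂ ++ u.reverse` is a `θ`-translate of a BASE POINT: a point of the `c₁`-trajectory of `w`
(shift `0`, or shift `a` for the start point reached again after `c₁`), a point `w · u.take i`, `1 ≤ i ≤ |u|`,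
of the connecting path (shift `a` on the way out, `0` on the way back), or an interior point of the
`c₂`-trajectory of `w'` (shift `a + e`). [this line] -/
theorem repr (μ : Fin 3 → Perm (Fin n)) (hμ : ∀ c, μ c * μ c = 1) (θ : Perm (Fin n))
    (hθ : ∀ c v, θ (μ c v) = μ c (θ v)) (c₁ u c₂ : List (Fin 3)) (w w' : Fin n) (a e : ℤ)
    (h1 : c₁.foldl (fun v c => μ c v) w = (θ ^ a) w)
    (h2 : u.foldl (fun v c => μ c v) w = (θ ^ e) w')
    (h3 : c₂.foldl (fun v c => μ c v) w' = (θ ^ (-a)) w') (hu : 1 ≤ u.length)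
    (s : ℕ) (hs : s < (c₁ ++ (u ++ (c₂ ++ u.reverse))).length) :
    (∃ (i : ℕ) (α : ℤ), i < c₁.length + 1 ∧ (i < c₁.length ∨ i = 0) ∧ (α = 0 ∨ α = a) ∧
        ((c₁ ++ (u ++ (c₂ ++ u.reverse))).take s).foldl (fun v c => μ c v) w =
          (θ ^ α) ((c₁.take i).foldl (fun v c => μ c v) w)) ∨
      (∃ (i : ℕ) (α : ℤ), 1 ≤ i ∧ i ≤ u.length ∧ (α = 0 ∨ α = a) ∧
        ((c₁ ++ (u ++ (c₂ ++ u.reverse))).take s).foldl (fun v c => μ c v) w =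
          (θ ^ α) ((u.take i).foldl (fun v c => μ c v) w)) ∨
      (∃ i : ℕ, 1 ≤ i ∧ i < c₂.length ∧
        ((c₁ ++ (u ++ (c₂ ++ u.reverse))).take s).foldl (fun v c => μ c v) w =
          (θ ^ (a + e)) ((c₂.take i).foldl (fun v c => μ c v) w')) := by
  simp only [List.length_append, List.length_reverse] at hs
  rcases Nat.lt_or_ge s c₁.length with hs1 | hs1
  · -- segment 1
    refine Or.inl ⟨s, 0, by omega, Or.inl hs1, Or.inl rfl, ?_⟩
    rw [seg1 μ c₁ _ w s hs1.le, zpow_zero, Perm.one_apply]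
  obtain ⟨s', rfl⟩ : ∃ s', s = c₁.length + s' := ⟨s - c₁.length, by omega⟩
  rcases Nat.lt_or_ge s' u.length with hs2 | hs2
  · -- segment 2
    rcases Nat.eq_zero_or_pos s' with rfl | hpos
    · refine Or.inl ⟨0, a, by omega, Or.inr rfl, Or.inr rfl, ?_⟩
      rw [seg2 μ θ hθ c₁ u _ w a h1 0 (by omega), List.take_zero, List.foldl_nil, List.take_zero,
        List.foldl_nil]
    · refine Or.inr (Or.inl ⟨s', a, hpos, hs2.le, Or.inr rfl, ?_⟩)
      rw [seg2 μ θ hθ c₁ u _ w a h1 s' hs2.le]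
  obtain ⟨s'', rfl⟩ : ∃ s'', s' = u.length + s'' := ⟨s' - u.length, by omega⟩
  rcases Nat.lt_or_ge s'' c₂.length with hs3 | hs3
  · -- segment 3
    rcases Nat.eq_zero_or_pos s'' with rfl | hpos
    · refine Or.inr (Or.inl ⟨u.length, a, hu, le_rfl, Or.inr rfl, ?_⟩)
      rw [seg3 μ θ hθ c₁ u c₂ _ w w' a e h1 h2 0 (by omega), List.take_zero, List.foldl_nil,
        List.take_length, h2, zpow_app]
    · refine Or.inr (Or.inr ⟨s'', hpos, hs3, ?_⟩)
      rw [seg3 μ θ hθ c₁ u c₂ _ w w' a e h1 h2 s'' hs3.le]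
  · -- segment 4
    obtain ⟨s₃, rfl⟩ : ∃ s₃, s'' = c₂.length + s₃ := ⟨s'' - c₂.length, by omega⟩
    refine Or.inr (Or.inl ⟨u.length - s₃, 0, by omega, by omega, Or.inl rfl, ?_⟩)
    rw [seg4 μ hμ θ hθ c₁ u c₂ w w' a e h1 h2 h3 s₃, zpow_zero, Perm.one_apply]

/-- The exponent bookkeeping of a crossing: shifts `α, β ∈ {0, a}` of the two sides leave a power
`θ^(-α + (j + β))` with exponent `j`, `j + a` or `j - a` fixing `w`. [this line] -/
theorem exp_cases (θ : Perm (Fin n)) (w : Fin n) (a j α β : ℤ) (hα : α = 0 ∨ α = a)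
    (hβ : β = 0 ∨ β = a) (hj : (θ ^ j) w ≠ w) (hja : (θ ^ (j + a)) w ≠ w)
    (hjna : (θ ^ (j - a)) w ≠ w) (h : (θ ^ (-α + (j + β))) w = w) : False := by
  rcases hα with hα | hα <;> rcases hβ with hβ | hβ <;> rw [hα, hβ] at h
  · exact hj (by rw [show j = -0 + (j + 0) by ring]; exact h)
  · exact hja (by rw [show j + a = -0 + (j + a) by ring]; exact h)
  · exact hjna (by rw [show j - a = -a + (j + 0) by ring]; exact h)
  · exact hj (by rw [show j = -a + (j + a) by ring]; exact h)

/-- **No crossing between a dumbbell lift and its `θ^j`-translate.**  Hypotheses: the closing data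
`h1 h2 h3` of `DeckDumbbell.closed`; the base points — `w · c₁.take i` (`i < |c₁|`), `w · u.take i`
(`1 ≤ i ≤ |u|`), `w' · c₂.take i` (`1 ≤ i < |c₂|`) — lie in pairwise distinct `θ`-orbits (downstairs: the two
cycles are simple and disjoint and the connecting path is internally disjoint from both); a power of `θ`
fixing some point fixes `w` (free deck group); and `θ^j`, `θ^(j+a)`, `θ^(j-a)` move `w` (the shift `j` avoids
the gap set `{0, ±a}`).  Conclusion: `w · z.take s ≠ θ^j (w · z.take t)` for all `s, t < |z|`. [this line] -/
theorem noCross (μ : Fin 3 → Perm (Fin n)) (hμ : ∀ c, μ c * μ c = 1) (θ : Perm (Fin n))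
    (hθ : ∀ c v, θ (μ c v) = μ c (θ v)) (c₁ u c₂ : List (Fin 3)) (w w' : Fin n) (a e j : ℤ)
    (h1 : c₁.foldl (fun v c => μ c v) w = (θ ^ a) w)
    (h2 : u.foldl (fun v c => μ c v) w = (θ ^ e) w')
    (h3 : c₂.foldl (fun v c => μ c v) w' = (θ ^ (-a)) w') (hc₁ : 1 ≤ c₁.length) (hu : 1 ≤ u.length)
    (hfree : ∀ (k : ℤ) (v : Fin n), (θ ^ k) v = v → (θ ^ k) w = w)
    (hj : (θ ^ j) w ≠ w) (hja : (θ ^ (j + a)) w ≠ w) (hjna : (θ ^ (j - a)) w ≠ w)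
    (hAA : ∀ s t : ℕ, s < c₁.length → t < c₁.length → s ≠ t → ∀ k : ℤ,
      (c₁.take s).foldl (fun v c => μ c v) w ≠ (θ ^ k) ((c₁.take t).foldl (fun v c => μ c v) w))
    (hUU : ∀ s t : ℕ, 1 ≤ s → s ≤ u.length → 1 ≤ t → t ≤ u.length → s ≠ t → ∀ k : ℤ,
      (u.take s).foldl (fun v c => μ c v) w ≠ (θ ^ k) ((u.take t).foldl (fun v c => μ c v) w))
    (hCC : ∀ s t : ℕ, 1 ≤ s → s < c₂.length → 1 ≤ t → t < c₂.length → s ≠ t → ∀ k : ℤ,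
      (c₂.take s).foldl (fun v c => μ c v) w' ≠ (θ ^ k) ((c₂.take t).foldl (fun v c => μ c v) w'))
    (hAU : ∀ s t : ℕ, s < c₁.length → 1 ≤ t → t ≤ u.length → ∀ k : ℤ,
      (c₁.take s).foldl (fun v c => μ c v) w ≠ (θ ^ k) ((u.take t).foldl (fun v c => μ c v) w))
    (hAC : ∀ s t : ℕ, s < c₁.length → 1 ≤ t → t < c₂.length → ∀ k : ℤ,
      (c₁.take s).foldl (fun v c => μ c v) w ≠ (θ ^ k) ((c₂.take t).foldl (fun v c => μ c v) w'))
    (hUC : ∀ s t : ℕ, 1 ≤ s → s ≤ u.length → 1 ≤ t → t < c₂.length → ∀ k : ℤ,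
      (u.take s).foldl (fun v c => μ c v) w ≠ (θ ^ k) ((c₂.take t).foldl (fun v c => μ c v) w'))
    (s t : ℕ) (hs : s < (c₁ ++ (u ++ (c₂ ++ u.reverse))).length)
    (ht : t < (c₁ ++ (u ++ (c₂ ++ u.reverse))).length) :
    ((c₁ ++ (u ++ (c₂ ++ u.reverse))).take s).foldl (fun v c => μ c v) w ≠
      (θ ^ j) (((c₁ ++ (u ++ (c₂ ++ u.reverse))).take t).foldl (fun v c => μ c v) w) := by
  intro heq
  -- a translate relation between two base points of different kind / index is excluded by the orbit
  -- hypotheses; between a base point and itself it produces a power of `θ` fixing it, hence fixing `w`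
  have key : ∀ (x : Fin n) (k : ℤ), x = (θ ^ k) x → (θ ^ k) w = w := fun x k h => hfree k x h.symm
  -- indices `i < |c₁| ∨ i = 0` of kind A are `< |c₁|` since `1 ≤ |c₁|`
  have idxA : ∀ i : ℕ, (i < c₁.length ∨ i = 0) → i < c₁.length := fun i h => by
    rcases h with h | rfl
    · exact h
    · exact hc₁
  rcases repr μ hμ θ hθ c₁ u c₂ w w' a e h1 h2 h3 hu s hs with
    ⟨i, α, -, hi, hα, hs'⟩ | ⟨i, α, hi1, hi2, hα, hs'⟩ | ⟨i, hi1, hi2, hs'⟩ <;>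
  rcases repr μ hμ θ hθ c₁ u c₂ w w' a e h1 h2 h3 hu t ht with
    ⟨i', β, -, hi', hβ, ht'⟩ | ⟨i', β, hi1', hi2', hβ, ht'⟩ | ⟨i', hi1', hi2', ht'⟩
  -- A / A
  · rw [hs', ht', zpow_app] at heq
    have h' := eq_zpow_of_zpow_eq θ heq
    by_cases hii : i = i'
    · subst hii
      exact exp_cases θ w a j α β hα hβ hj hja hjna (key _ _ h')
    · exact hAA i i' (idxA i hi) (idxA i' hi') hii _ h'
  -- A / U
  · rw [hs', ht', zpow_app] at heq
    exact hAU i i' (idxA i hi) hi1' hi2' _ (eq_zpow_of_zpow_eq θ heq)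
  -- A / C
  · rw [hs', ht', zpow_app] at heq
    exact hAC i i' (idxA i hi) hi1' hi2' _ (eq_zpow_of_zpow_eq θ heq)
  -- U / A
  · rw [hs', ht', zpow_app] at heq
    exact hAU i' i (idxA i' hi') hi1 hi2 _ (eq_zpow_symm θ (eq_zpow_of_zpow_eq θ heq))
  -- U / U
  · rw [hs', ht', zpow_app] at heq
    have h' := eq_zpow_of_zpow_eq θ heq
    by_cases hii : i = i'
    · subst hii
      exact exp_cases θ w a j α β hα hβ hj hja hjna (key _ _ h')
    · exact hUU i i' hi1 hi2 hi1' hi2' hii _ h'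
  -- U / C
  · rw [hs', ht', zpow_app] at heq
    exact hUC i i' hi1 hi2 hi1' hi2' _ (eq_zpow_of_zpow_eq θ heq)
  -- C / A
  · rw [hs', ht', zpow_app] at heq
    exact hAC i' i (idxA i' hi') hi1 hi2 _ (eq_zpow_symm θ (eq_zpow_of_zpow_eq θ heq))
  -- C / U
  · rw [hs', ht', zpow_app] at heq
    exact hUC i' i hi1' hi2' hi1 hi2 _ (eq_zpow_symm θ (eq_zpow_of_zpow_eq θ heq))
  -- C / C
  · rw [hs', ht', zpow_app] at heq
    have h' := eq_zpow_of_zpow_eq θ heq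
    by_cases hii : i = i'
    · subst hii
      refine hj ?_
      have := key _ _ h'
      rwa [show -(a + e) + (j + (a + e)) = j by ring] at this
    · exact hCC i i' hi1 hi2 hi1' hi2' hii _ h'

end DeckDumbbell

open DeckDumbbell in
/-- **Deck twins over an equal-class dumbbell give a clean closed rung walk** (memo Theorem A, dumbbell
branch).  Data as in `DeckDumbbell.noCross`, plus: the dumbbell word `z = c₁ ++ u ++ c₂ ++ u.reverse` is
cyclically reduced (downstairs: the walk is non-backtracking, which holds because the connecting path leaves
each cycle by the third edge), and the trajectory of `w` and its `θ^j`-translate avoid `R`.  Conclusion: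
clean closed-rung-walk data in the exact output format of the line's open core `stub_poorRigidCore` with
`k + 1 = |z|` rungs (`DeckDumbbell.closed`, `DeckDumbbell.noCross`, `deckTwin_cleanWalk`). [this line, k21 memo §3] -/
theorem deckDumbbell_cleanWalk (n : ℕ) (μ : Fin 3 → Equiv.Perm (Fin n)) (hμ : ∀ c, μ c * μ c = 1)
    (R : Finset (Fin n)) (θ : Equiv.Perm (Fin n)) (hθ : ∀ c v, θ (μ c v) = μ c (θ v))
    (c₁ u c₂ z : List (Fin 3)) (hz : z = c₁ ++ (u ++ (c₂ ++ u.reverse))) (w w' : Fin n) (a e j : ℤ)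
    (h1 : c₁.foldl (fun v c => μ c v) w = (θ ^ a) w)
    (h2 : u.foldl (fun v c => μ c v) w = (θ ^ e) w')
    (h3 : c₂.foldl (fun v c => μ c v) w' = (θ ^ (-a)) w') (hc₁ : 1 ≤ c₁.length) (hu : 1 ≤ u.length)
    (hchain : List.IsChain (· ≠ ·) (z ++ z))
    (hfree : ∀ (k : ℤ) (v : Fin n), (θ ^ k) v = v → (θ ^ k) w = w)
    (hj : (θ ^ j) w ≠ w) (hja : (θ ^ (j + a)) w ≠ w) (hjna : (θ ^ (j - a)) w ≠ w)
    (hAA : ∀ s t : ℕ, s < c₁.length → t < c₁.length → s ≠ t → ∀ k : ℤ,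
      (c₁.take s).foldl (fun v c => μ c v) w ≠ (θ ^ k) ((c₁.take t).foldl (fun v c => μ c v) w))
    (hUU : ∀ s t : ℕ, 1 ≤ s → s ≤ u.length → 1 ≤ t → t ≤ u.length → s ≠ t → ∀ k : ℤ,
      (u.take s).foldl (fun v c => μ c v) w ≠ (θ ^ k) ((u.take t).foldl (fun v c => μ c v) w))
    (hCC : ∀ s t : ℕ, 1 ≤ s → s < c₂.length → 1 ≤ t → t < c₂.length → s ≠ t → ∀ k : ℤ,
      (c₂.take s).foldl (fun v c => μ c v) w' ≠ (θ ^ k) ((c₂.take t).foldl (fun v c => μ c v) w'))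
    (hAU : ∀ s t : ℕ, s < c₁.length → 1 ≤ t → t ≤ u.length → ∀ k : ℤ,
      (c₁.take s).foldl (fun v c => μ c v) w ≠ (θ ^ k) ((u.take t).foldl (fun v c => μ c v) w))
    (hAC : ∀ s t : ℕ, s < c₁.length → 1 ≤ t → t < c₂.length → ∀ k : ℤ,
      (c₁.take s).foldl (fun v c => μ c v) w ≠ (θ ^ k) ((c₂.take t).foldl (fun v c => μ c v) w'))
    (hUC : ∀ s t : ℕ, 1 ≤ s → s ≤ u.length → 1 ≤ t → t < c₂.length → ∀ k : ℤ,
      (u.take s).foldl (fun v c => μ c v) w ≠ (θ ^ k) ((c₂.take t).foldl (fun v c => μ c v) w'))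
    (hRw : ∀ t : Fin z.length, (z.take (t : ℕ)).foldl (fun v c => μ c v) w ∉ R)
    (hRθ : ∀ t : Fin z.length, (θ ^ j) ((z.take (t : ℕ)).foldl (fun v c => μ c v) w) ∉ R) :
    ∃ (k : ℕ) (p q : Fin (k + 1) → Fin n) (col : Fin (k + 1) → Fin 3), (∀ i, p i ≠ q i) ∧
      (∀ i, (μ (col i) (p i) = p (i + 1) ∧ μ (col i) (q i) = q (i + 1)) ∨
        (μ (col i) (p i) = q (i + 1) ∧ μ (col i) (q i) = p (i + 1))) ∧
      (∀ i, col i ≠ col (i + 1)) ∧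
      (∀ i j, (p i = p j ∧ q i = q j) ∨ (p i = q j ∧ q i = p j) ∨
        (p i ≠ p j ∧ p i ≠ q j ∧ q i ≠ p j ∧ q i ≠ q j)) ∧
      (∀ i, p i ∉ R ∧ q i ∉ R) ∧ k + 1 = z.length := by
  subst hz
  have hlen : 2 ≤ (c₁ ++ (u ++ (c₂ ++ u.reverse))).length := by
    simp only [List.length_append, List.length_reverse]; omega
  exact deckTwin_cleanWalk n μ R (θ ^ j) (zpow_comm μ θ hθ j) _ w hlen hchain
    (closed μ hμ θ hθ c₁ u c₂ w w' a e h1 h2 h3)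
    (fun s t => noCross μ hμ θ hθ c₁ u c₂ w w' a e j h1 h2 h3 hc₁ hu hfree hj hja hjna
      hAA hUU hCC hAU hAC hUC s t s.isLt t.isLt)
    hRw hRθ

/-- **Registered form `stub_deckDumbbell`** (crux `stmt-MatrixMultiplication-10883`, helper of siege seat k21):
`deckDumbbell_cleanWalk` with all hypotheses spelled out. [this line] -/
theorem stub_deckDumbbell : ∀ (n : ℕ) (μ : Fin 3 → Equiv.Perm (Fin n)) (R : Finset (Fin n)) (θ : Equiv.Perm (Fin n)) (c₁ u c₂ z : List (Fin 3)) (w w' : Fin n) (a e j : ℤ), (∀ c, μ c * μ c = 1) → (∀ c v, θ (μ c v) = μ c (θ v)) → z = c₁ ++ (u ++ (c₂ ++ u.reverse)) → c₁.foldl (fun v c => μ c v) w = (θ ^ a) w → u.foldl (fun v c => μ c v) w = (θ ^ e) w' → c₂.foldl (fun v c => μ c v) w' = (θ ^ (-a)) w' → 1 ≤ c₁.length → 1 ≤ u.length → List.IsChain (· ≠ ·) (z ++ z) → (∀ (k : ℤ) (v : Fin n), (θ ^ k) v = v → (θ ^ k) w = w) → (θ ^ j) w ≠ w → (θ ^ (j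 + a)) w ≠ w → (θ ^ (j - a)) w ≠ w → (∀ s t : ℕ, s < c₁.length → t < c₁.length → s ≠ t → ∀ k : ℤ, (c₁.take s).foldl (fun v c => μ c v) w ≠ (θ ^ k) ((c₁.take t).foldl (fun v c => μ c v) w)) → (∀ s t : ℕ, 1 ≤ s → s ≤ u.length → 1 ≤ t → t ≤ u.length → s ≠ t → ∀ k : ℤ, (u.take s).foldl (fun v c => μ c v) w ≠ (θ ^ k) ((u.take t).foldl (fun v c => μ c v) w)) → (∀ s t : ℕ, 1 ≤ s → s < c₂.length → 1 ≤ t → t < c₂.length → s ≠ t → ∀ k : ℤ, (c₂.take s).foldl (fun v c => μ c v) w' ≠ (θ ^ k) ((c₂.take t).foldl (fun v c => μ c v) w')) → (∀ s t : ℕ, s < c₁.length → 1 ≤ t → t ≤ u.length → ∀ k : ℤ, (c₁.take s).foldl (fun v c => μ c v) w ≠ (θ ^ k) ((u.take t).foldl (fun v c => μ c v) w)) → (∀ s t : ℕ, s < c₁.length → 1 ≤ t → t < c₂.length → ∀ k : ℤ, (c₁.take s).foldl (fun v c => μ c v) w ≠ (θ ^ k) ((c₂.take t).foldl (fun v c =>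 μ c v) w')) → (∀ s t : ℕ, 1 ≤ s → s ≤ u.length → 1 ≤ t → t < c₂.length → ∀ k : ℤ, (u.take s).foldl (fun v c => μ c v) w ≠ (θ ^ k) ((c₂.take t).foldl (fun v c => μ c v) w')) → (∀ t : Fin z.length, (z.take (t : ℕ)).foldl (fun v c => μ c v) w ∉ R) → (∀ t : Fin z.length, (θ ^ j) ((z.take (t : ℕ)).foldl (fun v c => μ c v) w) ∉ R) → ∃ (k : ℕ) (p q : Fin (k + 1) → Fin n) (col : Fin (k + 1) → Fin 3), (∀ i, p i ≠ q i) ∧ (∀ i, (μ (col i) (p i) = p (i + 1) ∧ μ (col i) (q i) = q (i + 1)) ∨ (μ (col i) (p i) = q (i + 1) ∧ μ (col i) (q i) = p (i + 1))) ∧ (∀ i, col i ≠ col (i + 1)) ∧ (∀ i j, (p i = p j ∧ q i = q j) ∨ (p i = q j ∧ q i = p j) ∨ (p i ≠ p j ∧ p i ≠ q j ∧ q i ≠ p j ∧ q i ≠ q j)) ∧ (∀ i, p i ∉ R ∧ q i ∉ R) ∧ k + 1 = z.length :=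
  fun n μ R θ c₁ u c₂ z w w' a e j hμ hθ hz h1 h2 h3 hc₁ hu hchain hfree hj hja hjna hAA hUU hCC hAU hAC hUC hRw hRθ =>
    deckDumbbell_cleanWalk n μ hμ R θ hθ c₁ u c₂ z hz w w' a e j h1 h2 h3 hc₁ hu hchain hfree hj hja hjna
      hAA hUU hCC hAU hAC hUC hRw hRθ

end Summit.MatrixMultiplication.MatrixMultiplication.Theorems.HyperoctahedralThreshold
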